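import Literature.Probability.LatticeModels.Sweep1PassageFreeArcProofs
import Literature.Probability.LatticeModels.PlanarIsingCriticalMagnetization
import Literature.Probability.LatticeModels.FermionicObservableSums
import Literature.Probability.LatticeModels.SHolomorphicPrimitiveLaplacian
import HarnessLib

/-!
# Smirnov's Lemma 4.8: the FK-Ising observable is small away from the boundary arcs

Topic `Literature/Probability/LatticeModels`; an instalment of the discharge programme for
crit-ising.S18 (`Sweep1Proofs.lean`, Smirnov's Theorem 2.2 on the FK-Ising fermion), node 4 of
the DAG recorded there. Everything in this file is proved.

* `fkInterface_passageProb_le_holds`: the named fact `fkInterface_passageProb_le` of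
  `Sweep1Proofs.lean` (Smirnov 2010, Appendix A, Lemma A.1: the FK interface passes through an edge
  `r`-away from one of the arcs with probability `≤ ρ_r(δ) → 0`) is now a **theorem**: its proof
  architecture `fkInterface_passageProb_le_of_yang` (`Sweep1PassageProofs`,
  `Sweep1PassageFreeArcProofs`) fed with Yang's theorem `m*(β_c(2)) = 0`, which the tree proves
  (`spontaneousMagnetization_two_criticalBetaTwo_holds`, `PlanarIsingCriticalMagnetization`).
* `card_filter_cSrc_cornerOrbit_le_two`, `norm_passageSum_fkInterface_le_two`: the FK interface of
  admissible data passes through a medial vertex **at most twice** (the cut orbit does not repeat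
  a corner before its exit, `cornerOrbit_ne`, and exactly two coded corners are sourced at a given
  edge), so the integrand of the observable has norm `≤ 2 · 𝟙_{z ∈ γ}`.
* `norm_fkIsingObservable_le_two_mul_passageProb`: `‖F(z)‖ ≤ 2 P(z ∈ γ)` (Smirnov's
  `|F(e)| ≤ P(e ∈ γ)` for his edge observable; the factor `2` is the price of counting both
  passages of the vertex observable, cf. `F(v) = ∑_j F(c_j)/2` before Lemma 4.5).
* `norm_fkIsingObservable_le_of_infDist` and **`cornerFlux_fkIsingObservable_le_of_infDist`**
  (Smirnov 2010, **Lemma 4.8** with Remark 4.9, in the tree's rendering): for every `r > 0` there is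
  `ρ_r` with `ρ_r(δ) → 0` as `δ → 0⁺` such that for admissible discrete Dobrushin data discretising a
  Jordan domain and every edge `z` of `Ω_δ` at distance `≥ r` from the discrete arc `A` or from the
  discrete arc `B`, `‖F(z)‖ ≤ ρ_r(δ)`, and consequently the increment of the discrete primitive
  `H = Im ∫ (cF)²` across any corner sourced at `z` — `|H(B) - H(W)| = cornerFlux (c • F) q ≤ ‖c F(z)‖²`
  (`cornerFlux_le_norm_sq`) — is at most `‖c‖² ρ_r(δ)²`, uniformly in the domain ("the only way
  the shape of `Ω` enters into the estimate is via `r`", Rem. 4.9). The constant `c` is the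
  normalisation of node 1 (`isSHolomorphic_fkIsingObservable_of_zdArcA_connected`).

## References

* S. Smirnov, *Conformal invariance in random cluster models. I*, Ann. of Math. 172 (2010)
  1435–1467, Lemma 4.8, Remarks 4.9–4.10, eq. (4.?) `|H(B) - H(W)| = |F(e)|² ≤ P(e ∈ γ)²`,
  Appendix A Lemma A.1 — bib key `Smirnov2010`.
* C. N. Yang, Phys. Rev. 85 (1952) 808 — via `spontaneousMagnetization_two_criticalBetaTwo_holds`.
-/

noncomputable section

open MeasureTheory Filter Topology
open scoped NNReal ENNReal

namespace Literature.Probability.LatticeModels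

/-! ### Node 4 closed: the a priori estimate is a theorem -/

/-- **Smirnov's a priori estimate, proved** (the named fact `fkInterface_passageProb_le` of
`Sweep1Proofs.lean` discharged): for every `r > 0` there is `ρ_r → 0` (`δ → 0⁺`) bounding, for
all admissible discrete Dobrushin data on `δℤ²` discretising a Jordan domain, the probability that
the critical FK-Ising interface passes through an edge at distance `≥ r` from one of the discrete
arcs. Assembled from `fkInterface_passageProb_le_of_yang` (FKG comparison with a wired box,
planar duality for the free arc) and Yang's theorem
`spontaneousMagnetization_two_criticalBetaTwo_holds`. [cite: Smirnov2010, Appendix A, Lemma A.1; Lemma 4.8, Rem. 4.9] -/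
theorem fkInterface_passageProb_le_holds : fkInterface_passageProb_le :=
  fkInterface_passageProb_le_of_yang spontaneousMagnetization_two_criticalBetaTwo_holds

/-! ### The interface passes through a medial vertex at most twice -/

section Passages

variable {D : DiscreteDobrushin} {ω : Percolation.BondConfig (Site 2)} {c₀ : Site 2 × Fin 4}

/-- A coded corner is determined by its source edge and its vertex (the direction index is read
off the other endpoint). [folklore] -/
theorem eq_of_cSrc_eq_of_fst_eq {p q : Site 2 × Fin 4} (hs : cSrc p = cSrc q) (h1 : p.1 = q.1) :
    p = q := by
  obtain ⟨v, k⟩ := p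
  obtain ⟨w, j⟩ := q
  simp only at h1
  subst h1
  simp only [cSrc] at hs
  exact Prod.ext rfl (cornerUnit_injective (eq_of_sym2_add_eq hs))

/-- The vertex of a coded corner is an endpoint of its source edge. [folklore] -/
theorem fst_mem_cSrc (p : Site 2 × Fin 4) : p.1 ∈ cSrc p := Sym2.mem_mk_left _ _

/-- **At most two passages.** Along the cut orbit of a start corner of admissible data, run up to
a horizon `N` before which all faces are inner, at most two positions have a given source edge
`z`: the orbit corners are pairwise distinct (`cornerOrbit_ne`) and a corner sourced at `z` is
determined by which endpoint of `z` is its vertex. (Smirnov 2010, §4: "all passages of the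
interface through `v` (there might be up to two)".) [cite: Smirnov2010, §4 (before Lemma 4.5)] -/
theorem card_filter_cSrc_cornerOrbit_le_two (hD : D.IsZdAdmissible) (hc₀ : D.IsStartCorner c₀)
    {N : ℕ} (hN : ∀ k < N, D.IsInnerFace (cFace (cornerOrbit (D.bcBondConfig ω) c₀ k)))
    (z : MedialVertex) :
    ((Finset.range (N + 1)).filter
        (fun k => cSrc (cornerOrbit (D.bcBondConfig ω) c₀ k) = z)).card ≤ 2 := by
  classical
  induction z using Sym2.ind with
  | h a b =>
    set S := (Finset.range (N + 1)).filter
      (fun k => cSrc (cornerOrbit (D.bcBondConfig ω) c₀ k) = s(a, b)) with hS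
    have hinj : Set.InjOn (fun k => (cornerOrbit (D.bcBondConfig ω) c₀ k).1) S := by
      intro i hi j hj h
      rw [hS, Finset.coe_filter] at hi hj
      simp only [Finset.mem_range, Set.mem_setOf_eq] at hi hj
      have hij : cornerOrbit (D.bcBondConfig ω) c₀ i = cornerOrbit (D.bcBondConfig ω) c₀ j :=
        eq_of_cSrc_eq_of_fst_eq (hi.2.trans hj.2.symm) h
      by_contra hne
      rcases lt_or_gt_of_ne hne with hlt | hlt
      · exact cornerOrbit_ne hD hc₀ hlt (fun k hk => hN k (by omega)) hij
      · exact cornerOrbit_ne hD hc₀ hlt (fun k hk => hN k (by omega)) hij.symm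
    have hmaps : ∀ k ∈ S, (cornerOrbit (D.bcBondConfig ω) c₀ k).1 ∈ ({a, b} : Finset (Site 2)) := by
      intro k hk
      rw [hS, Finset.mem_filter] at hk
      have hmem := fst_mem_cSrc (cornerOrbit (D.bcBondConfig ω) c₀ k)
      rw [hk.2] at hmem
      simpa using hmem
    calc S.card ≤ ({a, b} : Finset (Site 2)).card := Finset.card_le_card_of_injOn _ hmaps hinj
      _ ≤ 2 := (Finset.card_insert_le _ _).trans (by simp)

/-- Each summand of a passage sum is a unit complex number. [folklore] -/
theorem norm_exp_neg_I_mul (spin w : ℝ) :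
    ‖Complex.exp (-Complex.I * spin * (w : ℝ))‖ = 1 := by
  have : -Complex.I * spin * (w : ℝ) = ((-(spin * w) : ℝ) : ℂ) * Complex.I := by
    push_cast; ring
  rw [this, Complex.norm_exp_ofReal_mul_I]

/-- The passage sum of a cut orbit (horizon `N` with inner faces before it) through any medial
vertex has norm at most `2`. [cite: Smirnov2010, §4 (before Lemma 4.5)] -/
theorem norm_passageSum_explorationList_le_two (hD : D.IsZdAdmissible) (hc₀ : D.IsStartCorner c₀)
    {N : ℕ} (hN : ∀ k < N, D.IsInnerFace (cFace (cornerOrbit (D.bcBondConfig ω) c₀ k)))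
    (δ spin : ℝ) (z : MedialVertex) :
    ‖passageSum (explorationList (D.bcBondConfig ω) c₀ N) δ spin z‖ ≤ 2 := by
  rw [passageSum_explorationList]
  refine (norm_sum_le _ _).trans ?_
  simp only [norm_exp_neg_I_mul, Finset.sum_const, nsmul_eq_mul, mul_one]
  exact_mod_cast card_filter_cSrc_cornerOrbit_le_two hD hc₀ hN z

/-- **The FK interface of admissible data passes through a medial vertex at most twice**: the
passage sum of `fkInterface E ω` has norm `≤ 2`, for every configuration `ω`.
[cite: Smirnov2010, §4 (before Lemma 4.5)] -/
theorem norm_passageSum_fkInterface_le_two {E : DiscreteDobrushin} (hE : E.IsZdAdmissible)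
    (ω : Percolation.BondConfig (Site 2)) (δ spin : ℝ) (z : MedialVertex) :
    ‖passageSum (fkInterface E ω) δ spin z‖ ≤ 2 := by
  rw [fkInterface, DiscreteDobrushin.medialExploration_eq_explorationList hE]
  exact norm_passageSum_explorationList_le_two hE (DiscreteDobrushin.isStartCorner_startCorner hE)
    (fun k hk => DiscreteDobrushin.isInnerFace_of_lt_exitTime hE _ hk) δ spin z

/-- The integrand of the observable is dominated by twice the indicator of a passage:
`‖passageSum (γ_ω) z‖ ≤ 2 · 𝟙[z ∈ γ_ω]`. [cite: Smirnov2010, §4 (before Lemma 4.5)] -/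
theorem norm_passageSum_fkInterface_le_ite {E : DiscreteDobrushin} (hE : E.IsZdAdmissible)
    (ω : Percolation.BondConfig (Site 2)) (δ spin : ℝ) (z : MedialVertex) :
    ‖passageSum (fkInterface E ω) δ spin z‖ ≤ if z ∈ fkInterface E ω then 2 else 0 := by
  split_ifs with h
  · exact norm_passageSum_fkInterface_le_two hE ω δ spin z
  · rw [passageSum_eq_zero_of_not_mem δ spin h, norm_zero]

end Passages

/-! ### `‖F(z)‖ ≤ 2 P(z ∈ γ)` -/

namespace DiscreteDobrushin

open scoped Classical in
/-- Probabilities under the FK interface measure are finite weighted sums of indicator values: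
`φ(S) = ∑_{ω ⊆ E} (w(ω)/Z) 𝟙[ι ω ∈ S]`. (Grimmett 2006, §1.2, eq. (1.1)–(1.3); the measure is a
finite combination of Dirac masses.) [cite: Grimmett2006, §1.2] -/
theorem fkInterfaceMeasure_real_apply (D : DiscreteDobrushin) [Fintype (meshDomain D.Ω D.δ)]
    {p q : ℝ} (hp : p ∈ Set.Icc (0 : ℝ) 1) (hq : 0 < q) (S : Set (Percolation.BondConfig (Site 2))) :
    (D.fkInterfaceMeasure p q).real S =
      ∑ ω ∈ D.interfaceGraph.edgeFinset.powerset,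
        rcWeight D.interfaceGraph p q (Subtype.val ⁻¹' D.zdArcA) ω /
            rcPartitionFunction D.interfaceGraph p q (Subtype.val ⁻¹' D.zdArcA) *
          (if liftConfig D.Ω D.δ ω ∈ S then 1 else 0) := by
  classical
  have hZ := rcPartitionFunction_pos D.interfaceGraph hp hq (Subtype.val ⁻¹' D.zdArcA)
  simp only [fkInterfaceMeasure, measureReal_def, Measure.coe_finsetSum, Measure.coe_smul,
    Finset.sum_apply, Pi.smul_apply, smul_eq_mul, Measure.dirac_apply, Set.indicator_apply,
    Pi.one_apply, mul_ite, mul_one, mul_zero]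
  rw [ENNReal.toReal_sum (fun ω _ => by split_ifs <;> simp)]
  refine Finset.sum_congr rfl fun ω _ => ?_
  split_ifs with h
  · exact ENNReal.toReal_ofReal (div_nonneg (rcWeight_nonneg _ hp hq.le _ ω) hZ.le)
  · exact ENNReal.toReal_zero

end DiscreteDobrushin

/-- **`‖F(z)‖ ≤ 2 P(z ∈ γ)`.** For admissible Dobrushin data the FK fermionic observable (any spin,
any `p ∈ [0, 1]`, all passages counted) at a medial vertex `z` is bounded in norm by twice the
probability that the FK interface passes through `z`. (Smirnov 2010, proof of Lemma 4.11:
`|F(e)| ≤ P(e ∈ γ)` for the edge observable; the vertex observable counts up to two passages.)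
[cite: Smirnov2010, proofs of Lemma 4.8 and Lemma 4.11] -/
theorem norm_fkFermionicObservable_le_two_mul {E : DiscreteDobrushin} (hE : E.IsZdAdmissible)
    [Fintype (meshDomain E.Ω E.δ)] {p : ℝ} (hp : p ∈ Set.Icc (0 : ℝ) 1) (spin : ℝ) (z : MedialVertex) :
    ‖fkFermionicObservable E p spin z‖ ≤ 2 * (E.fkInterfaceMeasure p 2).real {ω | z ∈ fkInterface E ω} := by
  classical
  rw [fkFermionicObservable, DiscreteDobrushin.integral_fkInterfaceMeasure E hp two_pos,
    DiscreteDobrushin.fkInterfaceMeasure_real_apply E hp two_pos, Finset.mul_sum]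
  refine (norm_sum_le _ _).trans (Finset.sum_le_sum fun ω _ => ?_)
  have hc : 0 ≤ rcWeight E.interfaceGraph p 2 (Subtype.val ⁻¹' E.zdArcA) ω /
      rcPartitionFunction E.interfaceGraph p 2 (Subtype.val ⁻¹' E.zdArcA) :=
    div_nonneg (rcWeight_nonneg _ hp zero_le_two _ ω) (rcPartitionFunction_pos _ hp two_pos _).le
  rw [norm_smul, Real.norm_of_nonneg hc]
  have h := norm_passageSum_fkInterface_le_ite hE (liftConfig E.Ω E.δ ω) E.δ spin z
  have hmem : (z ∈ fkInterface E (liftConfig E.Ω E.δ ω)) ↔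
      liftConfig E.Ω E.δ ω ∈ {ω' : Percolation.BondConfig (Site 2) | z ∈ fkInterface E ω'} := Iff.rfl
  by_cases hz : z ∈ fkInterface E (liftConfig E.Ω E.δ ω)
  · rw [if_pos hz] at h
    rw [if_pos (hmem.1 hz)]
    nlinarith
  · rw [if_neg hz] at h
    rw [if_neg (fun h' => hz (hmem.2 h'))]
    have : ‖passageSum (fkInterface E (liftConfig E.Ω E.δ ω)) E.δ spin z‖ = 0 :=
      le_antisymm h (norm_nonneg _)
    rw [this]
    simp

/-- **`‖F(z)‖ ≤ 2 P(z ∈ γ)` for the critical FK-Ising observable and `fkDobrushinMeasure`**, for any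
`Fintype` structure on `Ω_δ` (they are all equal). [cite: Smirnov2010, proofs of Lemma 4.8 and Lemma 4.11] -/
theorem norm_fkIsingObservable_le_two_mul_passageProb {E : DiscreteDobrushin} (hE : E.IsZdAdmissible)
    [inst : Fintype (meshDomain E.Ω E.δ)] (z : MedialVertex) :
    ‖fkIsingObservable E criticalFKIsingParam z‖ ≤
      2 * (fkDobrushinMeasure E).real {ω | z ∈ fkInterface E ω} := by
  have hinst : (meshDomain_finite hE.isBounded hE.delta_pos).fintype = inst := Subsingleton.elim _ _
  rw [fkDobrushinMeasure_of_pos E hE.isBounded hE.delta_pos, hinst]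
  exact norm_fkFermionicObservable_le_two_mul hE criticalFKIsingParam_mem_Icc (1 / 2) z

/-! ### Lemma 4.8: the observable, and the increments of `H`, are small away from the arcs -/

/-- **The observable is uniformly small away from the arcs** (Smirnov 2010, Remark 4.10: "`F → 0`
away from `a` and `b` as `δ → 0`", the content of Lemma 4.8). For every `r > 0` there is `ρ_r`
with `ρ_r(δ) → 0` as `δ → 0⁺` such that for all admissible discrete Dobrushin data `E` on `δℤ²`
discretising a Jordan domain and every edge `z` of `Ω_δ` at Euclidean distance `≥ r` from the
discrete arc `A` or from the discrete arc `B`, `‖F(z)‖ ≤ ρ_r(δ)` — with `F` the critical FK-Ising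
observable for any `Fintype` structure on `Ω_δ`; `ρ_r` depends on `r` only. [cite: Smirnov2010, Lemma 4.8, Rem. 4.9–4.10] -/
theorem norm_fkIsingObservable_le_of_infDist :
    ∀ r : ℝ, 0 < r → ∃ ρ : ℝ → ℝ, Tendsto ρ (𝓝[>] (0 : ℝ)) (𝓝 0) ∧
      ∀ (D : RandomPlanarGeometry.JordanDomain) (E : DiscreteDobrushin), E.Ω = D.carrier →
        E.IsZdAdmissible → ∀ [Fintype (meshDomain E.Ω E.δ)],
        ∀ z : MedialVertex, z ∈ (discreteDomainGraph E.Ω E.δ).edgeSet →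
          (r ≤ Metric.infDist (medialPoint E.δ z) (meshPoint E.δ '' E.zdArcA) ∨
            r ≤ Metric.infDist (medialPoint E.δ z) (meshPoint E.δ '' E.zdArcB)) →
          ‖fkIsingObservable E criticalFKIsingParam z‖ ≤ ρ E.δ := by
  intro r hr
  obtain ⟨ρ, hρ, h⟩ := fkInterface_passageProb_le_holds r hr
  refine ⟨fun δ => 2 * ρ δ, by simpa using hρ.const_mul 2, fun D E hΩ hE _ z hz hfar => ?_⟩
  exact (norm_fkIsingObservable_le_two_mul_passageProb hE z).trans
    (mul_le_mul_of_nonneg_left (h D E hΩ hE z hz hfar) zero_le_two)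

/-- **Smirnov's Lemma 4.8** in the tree's rendering. For every `r > 0` there is `ρ_r` with
`ρ_r(δ) → 0` as `δ → 0⁺` such that, for all admissible discrete Dobrushin data `E` on `δℤ²`
discretising a Jordan domain, every constant `c` (the normalisation of node 1) and every coded
corner `q` whose source edge is an edge of `Ω_δ` at distance `≥ r` from the discrete arc `A` or
from the discrete arc `B`, the increment of the discrete primitive `H = Im ∫ (cF)²` across `q` —
`H(B) - H(W) = cornerFlux (c • F) q` for any primitive pair (`IsPrimitivePair`, Lemma 3.6) —
satisfies `0 ≤ H(B) - H(W) ≤ ‖c‖² ρ_r(δ)`: "the restrictions of `H` to black and white squares are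
uniformly close to each other away from `a` and `b`" (Rem. 4.9), the shape of `Ω` entering only
via `r`. Proof as printed: `|H(B) - H(W)| = |F(e)|² ≤ P(e ∈ γ)²` (`cornerFlux_le_norm_sq`,
`norm_fkIsingObservable_le_two_mul_passageProb`) and Lemma A.1 (`fkInterface_passageProb_le_holds`).
[cite: Smirnov2010, Lemma 4.8 and its proof, Rem. 4.9] -/
theorem cornerFlux_fkIsingObservable_le_of_infDist :
    ∀ r : ℝ, 0 < r → ∃ ρ : ℝ → ℝ, Tendsto ρ (𝓝[>] (0 : ℝ)) (𝓝 0) ∧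
      ∀ (D : RandomPlanarGeometry.JordanDomain) (E : DiscreteDobrushin), E.Ω = D.carrier →
        E.IsZdAdmissible → ∀ [Fintype (meshDomain E.Ω E.δ)], ∀ (c : ℂ) (q : Site 2 × Fin 4),
        cSrc q ∈ (discreteDomainGraph E.Ω E.δ).edgeSet →
          (r ≤ Metric.infDist (medialPoint E.δ (cSrc q)) (meshPoint E.δ '' E.zdArcA) ∨
            r ≤ Metric.infDist (medialPoint E.δ (cSrc q)) (meshPoint E.δ '' E.zdArcB)) →
          cornerFlux (fun z => c * fkIsingObservable E criticalFKIsingParam z) q ≤ ‖c‖ ^ 2 * ρ E.δ := by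
  intro r hr
  obtain ⟨ρ, hρ, h⟩ := norm_fkIsingObservable_le_of_infDist r hr
  refine ⟨fun δ => ρ δ ^ 2, by simpa using hρ.pow 2, fun D E hΩ hE _ c q hq hfar => ?_⟩
  have hF := h D E hΩ hE (cSrc q) hq hfar
  have h0 : 0 ≤ ‖fkIsingObservable E criticalFKIsingParam (cSrc q)‖ := norm_nonneg _
  calc cornerFlux (fun z => c * fkIsingObservable E criticalFKIsingParam z) q
      ≤ ‖c * fkIsingObservable E criticalFKIsingParam (cSrc q)‖ ^ 2 := by
        obtain ⟨v, k⟩ := q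
        exact cornerFlux_le_norm_sq _ v k
    _ = ‖c‖ ^ 2 * ‖fkIsingObservable E criticalFKIsingParam (cSrc q)‖ ^ 2 := by
        rw [norm_mul, mul_pow]
    _ ≤ ‖c‖ ^ 2 * ρ E.δ ^ 2 := by
        gcongr

end Literature.Probability.LatticeModels
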